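/-
Copyright (c) 2026 the pub-hodgecm-mathlib formalisation cell (harness21).  Prover seat hodgecm-mathlib-F0P3b-p01 (g25); E1 keeper ∕ dealer F0P3a-p03 (g29), E1 BRICK
LEDGER row 40′ «(d1′) THE JACQUET ALTERNATIVE of a self-extension of a character» (keeper 2026-09-03T02:27:27Z «D′, yours after D ★»; census K2PI2-SELFEXT v1 §0-D).
-/
import Literature.RepresentationTheory.CharacterSelfExtensionModel   -- ★ CHAR-EXT B p852829: `exists_additive_apply_base_eq`, `exists_fixedVector_iff_additive_eq_zero`, `exists_linearEquiv_unipotent_model`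
import Mathlib.RepresentationTheory.Intertwining
import Mathlib.LinearAlgebra.Dimension.Constructions
import Mathlib.LinearAlgebra.FiniteDimensional.Defs
import HarnessLib

/-!
# The alternative of a self-extension of a character: `2 ≤ dim Hom_M(N, χ)` (split) OR an intertwiner to the unipotent model missing its sub (non-split)

Generic representation theory over a field `k` (any monoid `M`), Mathlib + ★ `CharacterSelfExtensionModel`, THEOREMS ONLY (no `def`, no instance, no named fact).
Namespace `Literature.RepresentationTheory`.  Cell `pub/hodgecm-mathlib`, crux H413 = `stmt-HodgeConjecture-24833` (`--supports` lane), E1 BRICK LEDGER (F0P3a-p03 (g29)) row 40′: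
the (d1′) input `hJ` of ★ row 40 D `Theorems/F0P3cStCharTSK2PiTwoSelfExtSplit.exists_section_selfExtension_of_jacquet_alternative` read off a SELF-EXTENSION OF A CHARACTER — at the CM
datum `N := r_B E` for a smooth self-extension `E` of `π²(ξ) ⊂ i_B(χ_ξ)` (`r_B` exact ★ `jacquetMap_exact`∕`_cmBorel_injective`∕`_surjective`; `r_B π²(ξ)` the `χ_ξ`-line [Keys1984]).
Seat F0P3b-p01 (g25).

THE MATHEMATICS.  `N : Representation k M U` is a SELF-EXTENSION OF THE CHARACTER `χ : M →* k` in ★ CHAR-EXT's letters: a functional `p : U →ₗ k` with `p (N m u) = χ m · p u`, `M` acting by `χ`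
on `ker p`, a base vector `u₀` (`p u₀ = 1`), `ker p` the free line on `e`; `χ` unit-valued; `χ₁` is the `χ`-line as a representation on `k` (`χ₁ m x = χ m · x`).  By ★ CHAR-EXT B the
extension has a scalar ADDITIVE CHARACTER `λ` (`N m u₀ − χ m u₀ = χ m λ(m) e`) and SPLITS iff `λ = 0` (§2 `exists_scalar_additive`).  SPLIT ⇒ `M` acts by `χ` on all of `U ≅ k²`, every
functional is an intertwiner into `χ₁`, and `dim_k Hom_M(N, χ₁) ≥ 2` (§1).  NON-SPLIT ⇒ `λ ≠ 0` and the universal isomorphism `Φ : k × k ≃ U` (`Φ (x, y) = x e + y u₀`) with CHAR-EXT's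
model, followed by the coordinate SWAP, is an intertwiner `θ : N → N₀` onto the model in the JET letters `N₀ m (w₁, w₂) = (χ m w₁, λ m χ m w₁ + χ m w₂)` (sub `0 × k`, quotient = first
coordinate — ★ J1∕J2∕D's `hN₀`) with `(θ u₀).1 = 1`; a non-zero RESCALING `λ = c·λ′` moves `θ` to the model of `λ′` (§2 `exists_intertwiningMap_unipotentModel_rescale`), so the
consumer may use ITS `λ′` (e.g. `ord_w`, ★ LC-ADDITIVE `additive_eq_zsmul_of_eq_zero_on_open`).
* §1 `forall_apply_eq_smul_of_split`, `intertwining_of_split`, **`two_le_finrank_intertwiningMap_of_split`**.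
* §2 `exists_scalar_additive`, `finiteDimensional_selfExtension`, **`exists_intertwiningMap_unipotentModel_of_not_split`**, `exists_intertwiningMap_unipotentModel_rescale`.
* §3 **`jacquetAlternative_of_selfExtension_char`** — `(2 ≤ finrank k (IntertwiningMap N χ₁)) ∨ ∃ λ ≠ 0 additive, ∀ N₀ of shape λ, ∃ θ : N → N₀, (θ u₀).1 ≠ 0` = ★ D's `hJ`.
[cite: Brown1982, Ch. III §1 Exercise 2 p. 60; Ch. IV §2 Prop. 2.1 p. 87, Prop. 2.3 p. 89] [cite: Keys1984, §3 pp. 118–119] [cite: BernsteinZelevinsky1977, §2.3]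
HONEST LABEL: count-neutral generic layer; WHICH `λ` occurs, and (ND) for its height jet, stay the consumer's hypotheses; HC_CM is proved only modulo the printed citations of that
programme until its rung 0 closes.

## References
* [Brown1982] K. S. Brown, *Cohomology of Groups*, GTM 87 (1982), Ch. III §1 Ex. 2 p. 60; Ch. IV §2 Prop. 2.1 p. 87, Prop. 2.3 p. 89.
* [Keys1984] D. Keys, *Principal series representations of special unitary groups over local fields*, Compositio Math. 51 (1984), §3 pp. 118–119.
* [BernsteinZelevinsky1977] I. N. Bernstein, A. V. Zelevinsky, *Induced representations of reductive p-adic groups I*, Ann. Sci. ÉNS 10 (1977), §2.3.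
-/

set_option autoImplicit false

namespace Literature.RepresentationTheory

open Representation

section SelfExtensionChar

variable {k : Type*} [Field k] {M : Type*} [Monoid M] {U : Type*} [AddCommGroup U] [Module k U]
  (N : Representation k M U) (χ : M →* k) (hχ : ∀ m, IsUnit (χ m)) (p : U →ₗ[k] k)
  (hquot : ∀ (m : M) (u : U), p (N m u) = χ m * p u) (hker : ∀ (m : M) (u : U), p u = 0 → N m u = χ m • u)
  {u₀ e : U} (hu₀ : p u₀ = 1) (he : p e = 0) (hline : ∀ w : U, p w = 0 → ∃ c : k, w = c • e) (hfree : ∀ c : k, c • e = 0 → c = 0)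
  (χ₁ : Representation k M k) (hχ₁ : ∀ (m : M) (x : k), χ₁ m x = χ m * x)

/-! ## §1 The split case -/

include hker in
/-- In the SPLIT case (an invariant base vector `v₀`, `p v₀ = 1`, `N m v₀ = χ m v₀`), `M` acts by the scalar `χ m` on EVERY vector: `w = (w − p w·v₀) + p w·v₀` with the first summand in
`ker p`. [cite: Brown1982, Ch. IV §2 Prop. 2.3 p. 89] -/
theorem forall_apply_eq_smul_of_split {v₀ : U} (hv₀ : p v₀ = 1) (hinv : ∀ m, N m v₀ = χ m • v₀) (m : M) (w : U) : N m w = χ m • w := by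
  have hw : p (w - p w • v₀) = 0 := by rw [map_sub, map_smul, hv₀, smul_eq_mul, mul_one, sub_self]
  have h2 : N m w = N m (w - p w • v₀) + p w • N m v₀ := by rw [map_sub, map_smul, sub_add_cancel]
  rw [h2, hker m _ hw, hinv, smul_sub, smul_comm (p w) (χ m) v₀, sub_add_cancel]

include hker hχ₁ in
/-- In the split case EVERY functional `f : U → k` intertwines `N` with the `χ`-line `χ₁`. [cite: Brown1982, Ch. IV §2 Prop. 2.3 p. 89] -/
theorem intertwining_of_split {v₀ : U} (hv₀ : p v₀ = 1) (hinv : ∀ m, N m v₀ = χ m • v₀) (f : U →ₗ[k] k) (m : M) (w : U) :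
    f (N m w) = χ₁ m (f w) := by
  rw [forall_apply_eq_smul_of_split N χ p hker hv₀ hinv m w, map_smul, hχ₁, smul_eq_mul]

/-! ## §2 The scalar additive character; finite dimension; the non-split case -/

include hχ hquot hker hu₀ hline hfree in
/-- **THE SCALAR ADDITIVE CHARACTER** on the free line: there is `λ : M → k`, `λ 1 = 0`, `λ(m m′) = λ m + λ m′`, with `N m u₀ − χ m u₀ = (χ m · λ m) e` for all `m`, and the extension
SPLITS iff `λ = 0` (★ CHAR-EXT B `exists_additive_apply_base_eq` + `exists_fixedVector_iff_additive_eq_zero`, the vector character `Λ m = λ m · e`).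
[cite: Brown1982, Ch. III §1 Exercise 2 p. 60; Ch. IV §2 Prop. 2.3 p. 89] -/
theorem exists_scalar_additive :
    ∃ lam : M → k, lam 1 = 0 ∧ (∀ m m' : M, lam (m * m') = lam m + lam m') ∧ (∀ m : M, N m u₀ - χ m • u₀ = (χ m * lam m) • e) ∧
      ((∃ v₀ : U, p v₀ = 1 ∧ ∀ m, N m v₀ = χ m • v₀) ↔ ∀ m, lam m = 0) := by
  obtain ⟨Λ, hΛ1, hΛmul, hΛp, hΛu⟩ := exists_additive_apply_base_eq N χ p hquot hker hχ u₀
  choose lam hlam using fun m => hline (Λ m) (hΛp m)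
  have hlam_inj : ∀ m m', Λ m = Λ m' → lam m = lam m' := fun m m' h => by
    have h2 : (lam m - lam m') • e = 0 := by rw [sub_smul, ← hlam, ← hlam, h, sub_self]
    exact sub_eq_zero.1 (hfree _ h2)
  refine ⟨lam, ?_, fun m m' => ?_, fun m => ?_, ?_⟩
  · have h0 : lam 1 • e = 0 := by rw [← hlam, hΛ1]
    exact hfree _ h0
  · have h2 : (lam (m * m') - (lam m + lam m')) • e = 0 := by rw [sub_smul, add_smul, ← hlam, ← hlam, ← hlam, hΛmul, sub_self]
    exact sub_eq_zero.1 (hfree _ h2)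
  · rw [hΛu m, smul_add, add_sub_cancel_left, hlam, smul_smul]
  · rw [exists_fixedVector_iff_additive_eq_zero N χ p hker hχ hu₀ hΛu]
    refine forall_congr' fun m => ⟨fun h => hfree _ (by rw [← hlam, h]), fun h => by rw [hlam, h, zero_smul]⟩

include hχ hquot hker hu₀ he hline hfree in
/-- `U` is FINITE-DIMENSIONAL (the universal isomorphism `k × k ≃ U` of ★ CHAR-EXT B). [cite: Brown1982, Ch. IV §2 Prop. 2.1 p. 87] -/
theorem finiteDimensional_selfExtension : FiniteDimensional k U := by
  obtain ⟨lam, -, -, hΛ, -⟩ := exists_scalar_additive N χ hχ p hquot hker hu₀ hline hfree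
  obtain ⟨Φ, -, -, -⟩ := exists_linearEquiv_unipotent_model N χ p hker hu₀ he hline hfree lam hΛ
  exact Module.Finite.equiv Φ

include hχ hquot hker hu₀ he hline hfree hχ₁ in
/-- **SPLIT ⇒ `2 ≤ dim_k Hom_M(N, χ₁)`**: the coordinate functionals of the basis `(e, v₀)` (universal isomorphism at the INVARIANT base vector `v₀`, derivation `0`) are two linearly
independent intertwiners `N → χ₁` (§1: every functional intertwines). [cite: Brown1982, Ch. IV §2 Prop. 2.1 p. 87, Prop. 2.3 p. 89] -/
theorem two_le_finrank_intertwiningMap_of_split {v₀ : U} (hv₀ : p v₀ = 1) (hinv : ∀ m, N m v₀ = χ m • v₀) :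
    2 ≤ Module.finrank k (IntertwiningMap N χ₁) := by
  haveI : FiniteDimensional k U := finiteDimensional_selfExtension N χ hχ p hquot hker hu₀ he hline hfree
  -- the basis `(e, v₀)`: universal isomorphism at base vector `v₀` with zero derivation
  obtain ⟨Φ, hΦ, -, -⟩ := exists_linearEquiv_unipotent_model N χ p hker hv₀ he hline hfree (fun _ => 0)
    (fun m => by rw [hinv, sub_self, mul_zero, zero_smul])
  -- the two coordinate functionals as intertwiners
  let q₁ : U →ₗ[k] k := LinearMap.fst k k k ∘ₗ Φ.symm.toLinearMap
  let q₂ : U →ₗ[k] k := LinearMap.snd k k k ∘ₗ Φ.symm.toLinearMap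
  let T₁ : IntertwiningMap N χ₁ := q₁.intertwiningMap_of_isIntertwiningMap N χ₁ (intertwining_of_split N χ p hker χ₁ hχ₁ hv₀ hinv q₁)
  let T₂ : IntertwiningMap N χ₁ := q₂.intertwiningMap_of_isIntertwiningMap N χ₁ (intertwining_of_split N χ p hker χ₁ hχ₁ hv₀ hinv q₂)
  have hΦe : Φ.symm e = ((1 : k), (0 : k)) := by rw [LinearEquiv.symm_apply_eq, hΦ, one_smul, zero_smul, add_zero]
  have hΦv : Φ.symm v₀ = ((0 : k), (1 : k)) := by rw [LinearEquiv.symm_apply_eq, hΦ, zero_smul, one_smul, zero_add]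
  have hT₁e : T₁ e = 1 := by change (Φ.symm e).1 = 1; rw [hΦe]
  have hT₁v : T₁ v₀ = 0 := by change (Φ.symm v₀).1 = 0; rw [hΦv]
  have hT₂e : T₂ e = 0 := by change (Φ.symm e).2 = 0; rw [hΦe]
  have hT₂v : T₂ v₀ = 1 := by change (Φ.symm v₀).2 = 1; rw [hΦv]
  have hli : LinearIndependent k ![T₁, T₂] := by
    refine LinearIndependent.pair_iff.2 fun s t hst => ?_
    have h1 : (s • T₁ + t • T₂) e = (0 : IntertwiningMap N χ₁) e := by rw [hst]
    have h2 : (s • T₁ + t • T₂) v₀ = (0 : IntertwiningMap N χ₁) v₀ := by rw [hst]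
    rw [IntertwiningMap.coe_add, Pi.add_apply, IntertwiningMap.smul_apply, IntertwiningMap.smul_apply, IntertwiningMap.coe_zero, Pi.zero_apply] at h1 h2
    rw [hT₁e, hT₂e, smul_eq_mul, smul_eq_mul, mul_one, mul_zero, add_zero] at h1
    rw [hT₁v, hT₂v, smul_eq_mul, smul_eq_mul, mul_zero, mul_one, zero_add] at h2
    exact ⟨h1, h2⟩
  have h := hli.fintype_card_le_finrank
  rwa [Fintype.card_fin] at h

include hχ hquot hker hu₀ he hline hfree in
/-- **NON-SPLIT ⇒ AN INTERTWINER ONTO THE UNIPOTENT MODEL MISSING ITS SUB** (JET letters).  If the self-extension does NOT split, its scalar additive character `λ` is non-zero and, for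
EVERY representation `N₀` on `k × k` of the shape `N₀ m (w₁, w₂) = (χ m w₁, λ m (χ m w₁) + χ m w₂)` (sub `0 × k`, quotient = first coordinate), there is an intertwiner `θ : N → N₀`
with `(θ u₀).1 = 1` — the universal isomorphism of ★ CHAR-EXT B followed by the coordinate swap. [cite: Brown1982, Ch. IV §2 Prop. 2.1 p. 87, Prop. 2.3 p. 89] [cite: Keys1984, §3 pp. 118–119] -/
theorem exists_intertwiningMap_unipotentModel_of_not_split (hns : ¬ ∃ v₀ : U, p v₀ = 1 ∧ ∀ m, N m v₀ = χ m • v₀) :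
    ∃ lam : M → k, lam 1 = 0 ∧ (∀ m m' : M, lam (m * m') = lam m + lam m') ∧ (∃ m, lam m ≠ 0) ∧
      ∀ (N₀ : Representation k M (k × k)), (∀ (m : M) (w : k × k), N₀ m w = (χ m * w.1, lam m * (χ m * w.1) + χ m * w.2)) →
        ∃ θ : IntertwiningMap N N₀, (θ u₀).1 = 1 := by
  obtain ⟨lam, hlam1, hlammul, hΛ, hsplit⟩ := exists_scalar_additive N χ hχ p hquot hker hu₀ hline hfree
  refine ⟨lam, hlam1, hlammul, ?_, fun N₀ hN₀ => ?_⟩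
  · by_contra h
    push Not at h
    exact hns (hsplit.2 h)
  · obtain ⟨Φ, hΦ, -, hΦN⟩ := exists_linearEquiv_unipotent_model N χ p hker hu₀ he hline hfree lam hΛ
    -- `θ := swap ∘ Φ⁻¹`
    let θl : U →ₗ[k] k × k := (LinearEquiv.prodComm k k k).toLinearMap ∘ₗ Φ.symm.toLinearMap
    have hθl : ∀ u : U, θl u = ((Φ.symm u).2, (Φ.symm u).1) := fun u => rfl
    have hθN : ∀ (m : M) (u : U), θl (N m u) = N₀ m (θl u) := fun m u => by
      obtain ⟨⟨x, y⟩, rfl⟩ := Φ.surjective u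
      rw [hθl, hθl, hΦN, LinearEquiv.symm_apply_apply, LinearEquiv.symm_apply_apply, hN₀]
      ext <;> (dsimp only; try ring)
    refine ⟨θl.intertwiningMap_of_isIntertwiningMap N N₀ hθN, ?_⟩
    have hu : Φ.symm u₀ = ((0 : k), (1 : k)) := by rw [LinearEquiv.symm_apply_eq, hΦ, zero_smul, one_smul, zero_add]
    change (θl u₀).1 = 1
    rw [hθl, hu]

/-- **RESCALING THE MODEL**: an intertwiner `θ : N → N₀` onto the model of `λ = c·λ′` with `(θ y).1 ≠ 0`, `c ≠ 0`, gives `θ′ : N → N₀′` onto the model of `λ′` with `(θ′ y).1 ≠ 0`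
(`(w₁, w₂) ↦ (c w₁, w₂)` intertwines the two models) — so the consumer may read the alternative with ITS additive character (e.g. `λ′ = ord_w`, `λ = c·ord_w` by ★ LC-ADDITIVE).
[cite: Brown1982, Ch. IV §2 Prop. 2.3 p. 89] -/
theorem exists_intertwiningMap_unipotentModel_rescale {V' : Type*} [AddCommGroup V'] [Module k V'] (τ : Representation k M V')
    (lam lam' : M → k) {c : k} (hc : c ≠ 0) (hlam : ∀ m, lam m = c * lam' m)
    (N₀ N₀' : Representation k M (k × k)) (hN₀ : ∀ (m : M) (w : k × k), N₀ m w = (χ m * w.1, lam m * (χ m * w.1) + χ m * w.2))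
    (hN₀' : ∀ (m : M) (w : k × k), N₀' m w = (χ m * w.1, lam' m * (χ m * w.1) + χ m * w.2))
    (θ : IntertwiningMap τ N₀) {y : V'} (hy : (θ y).1 ≠ 0) :
    ∃ θ' : IntertwiningMap τ N₀', (θ' y).1 ≠ 0 := by
  let D : (k × k) →ₗ[k] k × k := LinearMap.prod (c • LinearMap.fst k k k) (LinearMap.snd k k k)
  have hD : ∀ w : k × k, D w = (c * w.1, w.2) := fun w => rfl
  have hDN : ∀ (m : M) (w : k × k), D (N₀ m w) = N₀' m (D w) := fun m w => by
    rw [hD, hD, hN₀, hN₀', hlam]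
    ext <;> (dsimp only; try ring)
  have hθ' : ∀ (m : M) (v : V'), (D ∘ₗ θ.toLinearMap) (τ m v) = N₀' m ((D ∘ₗ θ.toLinearMap) v) := fun m v => by
    rw [LinearMap.comp_apply, LinearMap.comp_apply, IntertwiningMap.toLinearMap_apply, IntertwiningMap.toLinearMap_apply,
      IntertwiningMap.isIntertwining _ _ θ m v, hDN]
  refine ⟨(D ∘ₗ θ.toLinearMap).intertwiningMap_of_isIntertwiningMap τ N₀' hθ', ?_⟩
  change ((D ∘ₗ θ.toLinearMap) y).1 ≠ 0
  rw [LinearMap.comp_apply, IntertwiningMap.toLinearMap_apply, hD]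
  exact mul_ne_zero hc hy

/-! ## §3 The alternative -/

include hχ hquot hker hu₀ he hline hfree hχ₁ in
/-- **THE JACQUET ALTERNATIVE OF A SELF-EXTENSION OF A CHARACTER** (★ D's `hJ`): EITHER `2 ≤ dim_k Hom_M(N, χ₁)` (split), OR there is a non-zero additive `λ` such that for every
model `N₀` of shape `λ` in the JET letters some intertwiner `θ : N → N₀` misses the sub `0 × k` (`(θ u₀).1 ≠ 0`).  At the CM datum: `N := r_B E`, `χ = χ_ξ` on `T(L⁺_v)`.
[cite: Brown1982, Ch. III §1 Exercise 2 p. 60; Ch. IV §2 Prop. 2.3 p. 89] [cite: Keys1984, §3 pp. 118–119] [cite: BernsteinZelevinsky1977, §2.3] -/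
theorem jacquetAlternative_of_selfExtension_char :
    2 ≤ Module.finrank k (IntertwiningMap N χ₁) ∨
      ∃ lam : M → k, lam 1 = 0 ∧ (∀ m m' : M, lam (m * m') = lam m + lam m') ∧ (∃ m, lam m ≠ 0) ∧
        ∀ (N₀ : Representation k M (k × k)), (∀ (m : M) (w : k × k), N₀ m w = (χ m * w.1, lam m * (χ m * w.1) + χ m * w.2)) →
          ∃ θ : IntertwiningMap N N₀, ∃ y : U, (θ y).1 ≠ 0 := by
  by_cases hsplit : ∃ v₀ : U, p v₀ = 1 ∧ ∀ m, N m v₀ = χ m • v₀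
  · obtain ⟨v₀, hv₀, hinv⟩ := hsplit
    exact Or.inl (two_le_finrank_intertwiningMap_of_split N χ hχ p hquot hker hu₀ he hline hfree χ₁ hχ₁ hv₀ hinv)
  · obtain ⟨lam, h1, hmul, hne, hθ⟩ := exists_intertwiningMap_unipotentModel_of_not_split N χ hχ p hquot hker hu₀ he hline hfree hsplit
    refine Or.inr ⟨lam, h1, hmul, hne, fun N₀ hN₀ => ?_⟩
    obtain ⟨θ, hθ1⟩ := hθ N₀ hN₀
    exact ⟨θ, u₀, by rw [hθ1]; exact one_ne_zero⟩

/-! ## §4 (ED. 2, append-only) The alternative WITH THE OCCURRENCE RELATION — the same `λ` that satisfies `N m u₀ − χ m u₀ = (χ m·λ m) e` -/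

include hχ hquot hker hu₀ he hline hfree in
/-- **NON-SPLIT ⇒ INTERTWINER ONTO THE MODEL, WITH THE OCCURRENCE RELATION** (ED. 2): as `exists_intertwiningMap_unipotentModel_of_not_split`, but the additive `λ` returned is
THE scalar additive character of the extension — `N m u₀ − χ m • u₀ = (χ m · λ m) • e` for all `m` — so that a consumer's hypotheses quantified over the OCCURRING characters (a height
oracle, a non-deformation input) apply to it. [cite: Brown1982, Ch. IV §2 Prop. 2.1 p. 87, Prop. 2.3 p. 89] [cite: Keys1984, §3 pp. 118–119] -/
theorem exists_intertwiningMap_unipotentModel_of_not_split' (hns : ¬ ∃ v₀ : U, p v₀ = 1 ∧ ∀ m, N m v₀ = χ m • v₀) :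
    ∃ lam : M → k, lam 1 = 0 ∧ (∀ m m' : M, lam (m * m') = lam m + lam m') ∧ (∃ m, lam m ≠ 0) ∧
      (∀ m : M, N m u₀ - χ m • u₀ = (χ m * lam m) • e) ∧
      ∀ (N₀ : Representation k M (k × k)), (∀ (m : M) (w : k × k), N₀ m w = (χ m * w.1, lam m * (χ m * w.1) + χ m * w.2)) →
        ∃ θ : IntertwiningMap N N₀, (θ u₀).1 = 1 := by
  obtain ⟨lam, hlam1, hlammul, hΛ, hsplit⟩ := exists_scalar_additive N χ hχ p hquot hker hu₀ hline hfree
  refine ⟨lam, hlam1, hlammul, ?_, hΛ, fun N₀ hN₀ => ?_⟩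
  · by_contra h
    push Not at h
    exact hns (hsplit.2 h)
  · obtain ⟨Φ, hΦ, -, hΦN⟩ := exists_linearEquiv_unipotent_model N χ p hker hu₀ he hline hfree lam hΛ
    let θl : U →ₗ[k] k × k := (LinearEquiv.prodComm k k k).toLinearMap ∘ₗ Φ.symm.toLinearMap
    have hθl : ∀ u : U, θl u = ((Φ.symm u).2, (Φ.symm u).1) := fun u => rfl
    have hθN : ∀ (m : M) (u : U), θl (N m u) = N₀ m (θl u) := fun m u => by
      obtain ⟨⟨x, y⟩, rfl⟩ := Φ.surjective u
      rw [hθl, hθl, hΦN, LinearEquiv.symm_apply_apply, LinearEquiv.symm_apply_apply, hN₀]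
      ext <;> (dsimp only; try ring)
    refine ⟨θl.intertwiningMap_of_isIntertwiningMap N N₀ hθN, ?_⟩
    have hu : Φ.symm u₀ = ((0 : k), (1 : k)) := by rw [LinearEquiv.symm_apply_eq, hΦ, zero_smul, one_smul, zero_add]
    change (θl u₀).1 = 1
    rw [hθl, hu]

include hχ hquot hker hu₀ he hline hfree hχ₁ in
/-- **THE JACQUET ALTERNATIVE WITH THE OCCURRENCE RELATION** (ED. 2): EITHER `2 ≤ dim_k Hom_M(N, χ₁)`, OR there is a non-zero additive `λ` OCCURRING in `N`
(`N m u₀ − χ m • u₀ = (χ m · λ m) • e`) such that every model `N₀` of shape `λ` receives an intertwiner `θ : N → N₀` missing the sub.  This is the form consumed by ★ row 40″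
`F0P3cStCharTSK2PiTwoSelfExtSplitSentence` (its height oracle and (ND) input are quantified over the OCCURRING characters — an unrestricted oracle would be false at the datum).
[cite: Brown1982, Ch. III §1 Exercise 2 p. 60; Ch. IV §2 Prop. 2.3 p. 89] [cite: Keys1984, §3 pp. 118–119] [cite: BernsteinZelevinsky1977, §2.3] -/
theorem jacquetAlternative_of_selfExtension_char' :
    2 ≤ Module.finrank k (IntertwiningMap N χ₁) ∨
      ∃ lam : M → k, lam 1 = 0 ∧ (∀ m m' : M, lam (m * m') = lam m + lam m') ∧ (∃ m, lam m ≠ 0) ∧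
        (∀ m : M, N m u₀ - χ m • u₀ = (χ m * lam m) • e) ∧
        ∀ (N₀ : Representation k M (k × k)), (∀ (m : M) (w : k × k), N₀ m w = (χ m * w.1, lam m * (χ m * w.1) + χ m * w.2)) →
          ∃ θ : IntertwiningMap N N₀, ∃ y : U, (θ y).1 ≠ 0 := by
  by_cases hsplit : ∃ v₀ : U, p v₀ = 1 ∧ ∀ m, N m v₀ = χ m • v₀
  · obtain ⟨v₀, hv₀, hinv⟩ := hsplit
    exact Or.inl (two_le_finrank_intertwiningMap_of_split N χ hχ p hquot hker hu₀ he hline hfree χ₁ hχ₁ hv₀ hinv)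
  · obtain ⟨lam, h1, hmul, hne, hocc, hθ⟩ := exists_intertwiningMap_unipotentModel_of_not_split' N χ hχ p hquot hker hu₀ he hline hfree hsplit
    refine Or.inr ⟨lam, h1, hmul, hne, hocc, fun N₀ hN₀ => ?_⟩
    obtain ⟨θ, hθ1⟩ := hθ N₀ hN₀
    exact ⟨θ, u₀, by rw [hθ1]; exact one_ne_zero⟩

end SelfExtensionChar

end Literature.RepresentationTheory
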